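import Summits.AtomisticToContinuum.Crystallization.Theorems.ChartedZeroExcessLayeredLatticeLiouvillePB

/-!
# Zero-excess layered lattice Liouville — part Q (lens-2 g29, node «RegisteredHarmonicTrinity»): the residual-designate H♭^ℓ DECOMPOSED

Target (critic row 496 (iii), VERBATIM tree decl of part PB): `HalvingBasinPGL aHi Λ θ s` — the one-step ε-regularity («η-flat at radius `M·R` under an
`s`-conformal chart ⇒ `η/2`-flat at radius `R`») for θ-good GSC door sets.  Column instance `(aHi; Λ, θ, s) = (1; 2, 1/16, 1/50)`.

## The finding that drives the cut (why a NEW CURRENCY is forced, D-g28-1)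
In the misfit currencies of record (`NearHomBD`, `NearHomL2BD`, `NearHomL2BDL`) the chart map `Ψ` is an ENVIRONMENT-TYPE assignment with NO positional
meaning: `EnvClose τ r S x H (Ψ x)` matches the pattern `S − x` against the pattern `H − Ψ x`, so on a perfect layered window EVERY environment-preserving
`Ψ` has misfit `0` (cf. the calibration `nearHomBD_of_tol_ge`: «match `p ↦ Ψ x` and `q ↦ x`»).  The continuum ε-regularity scheme (Caccioppoli ⇒ harmonic
approximation ⇒ decay, [giaquinta1984 Ch. VI, p.120 Thm 3.1; Ch. IX pp 142–145]) runs on a DISPLACEMENT `u = x − Ψ x` whose discrete gradient is the misfit —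
this requires `Ψ` to be a REGISTRATION (neighbours go to neighbouring sites consistently).  In the continuum that step is free (Poincaré); here it is a
genuine Friesecke–James–Müller-type registration statement.  Hence the displacement-level currency `NearHomH1BD` / `NearHomH1BDE` of §II.1 (misfit =
GRADIENT level `κ`; position = `κ·ρ²` at scale `ρ`; registration-consistency clause; for `…E` the chart is an EQUILIBRIUM chart: conformal, clean and
single-site Nash as a homogeneous configuration — exactly the class on which `LayeredLiouvilleCert` certifies the linear theory).

## The cut (lens «structural dichotomy»: STRUCTURED = registered-harmonic part, decays by linear rigidity; GENERIC = defect, small by minimality)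
`H♭^ℓ(aHi;Λ,θ,s) ⟸ (P) RegistrationP(aHi;Λ,θ,s) ∧ (HD) HarmonicDecayPGL(aHi;Λ,θ,s,s') ∧ (C) CaccioppoliPGL(aHi;Λ,θ,s')` — PROVED
(`halvingBasinPGL_of_reg_harm_cacc`, pure bookkeeping: levels `η ↦ C_P η ↦ c·C_P η ↦ C_c·c·C_P η = η/2` with `c := 1/(2 C_c C_P)`, radii `M := M_P M_c / t`).
* (P)  misfit-flat under a conformal chart ⇒ REGISTERED-flat under an equilibrium chart, level `× C_P`, radius `÷ M_P` — RIGIDITY/EQUILIBRIUM-type, GSC-free.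
* (HD) registered-flat at `(ρ, η)` ⇒ registered-flat at `(t·ρ, c·η)` for every contraction target `c` (∀c ∃t) — the MERGED «harmonic approximation + linear
       decay» leaf (REGULARITY-type for minimisers; consumes both linear certificates); its `t²`-LAW form (HD²) `HarmonicDecayLawPGL` ⇒ (HD) PROVED.
* (C)  registered-flat ⇒ misfit-flat one radius down, level `× C_c` — the discrete CACCIOPPOLI inequality for e⋆-μ-GSC configurations (MINIMALITY-type):
       competitor = atoms moved onto the registered chart inside, untouched outside, interpolated on a collar; equal particle number, and the μ = e⋆
       bookkeeping PAYS for deleting the Chebyshev-bad collar atoms (≤ C η·#, cost |e⋆| each) — no sup-smallness needed.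
Columns: `_16XH3` (NINE opaque leaves: LLC, LLC′, R_G, X, Z_E, P, HD, C, HBG″) and its resolved 13-leaf audit form; `_16XH3law` with (HD²).
0 EQUIV.  Every new `def` is a `Prop` or a `Prop`-valued predicate; no instance / notation / set_option.

## Answer to critic row 508 (the binder question of TAG 174 (a‴)) — NO gap cap is typed; the John input moves to EQUILIBRIUM charts
The binders of H♭^ℓ / K^ℓ in part PB are VERBATIM `IsDoorSetPG aHi δ S` (rooted, δ-separated, `IsCleanP aHi` = (1/16, 9/10, aHi)-clean, single-site Nash,
charted, e⋆-GSC), `∀ q ∈ S, IsTwoShellAffineGood θ S q` and `NearHomL2BDL a s Λ η 4 S (window)` (chart `L` `s`-conformal about `a`, stacking data `w` FREE):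
they say «(1/16)-clean», NOT «gap ≤ 0.87·b».  This part does not add a cap literal.  Instead the cut below routes EVERY use of Hessian positivity through
EQUILIBRIUM charts (`IsEquilChart`: the homogeneous chart state is clean AND single-site Nash), and single-site Nash of a homogeneous layered state forces
hollow registries (bridge/atop registries are in-plane force-free by symmetry but not single-site minima) and the equilibrium gap `γ_eq(L, word)·b`
(zero normal force) — so the census' clean-but-unstable family «ABC, γ = 0.90, bridge shift 0.2, in-plane +2 %» (λ_rel = −0.0068) is NOT an equilibrium
chart and is excluded BY TYPE from (HD) and (C).  The price «clean conformal chart ⇒ equilibrium conformal chart at comparable level» is paid ONCE, in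
(P), by single-site Nash of the CONFIGURATION `S` (force transfer: an `η`-flat Nash configuration fits only charts whose per-layer force is `O(√η)`), an
EQUILIBRIUM-type statement with basin `η₁` — which is also why H♭^ℓ itself is not falsified by the named family: for `η ≤ κ₀` no GSC door set is `η`-flat
under a chart with per-layer force `≈ 0.2·κ_reg` on a window `R ≥ R₀`.  Census asks: TAG 174 (a⁗) EQUILIBRIUM SLICE (min λ_rel over the 2 % conformal
slice × words ≤ 4 at hollow registry and `γ = γ_eq(L, word)`; expected ≥ +0.15 from the (a‴) rows γ ≤ 0.85) and TAG «FORCE» (per-layer force of the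
named family vs. distance to the nearest equilibrium stacking).  Z_E's numbers of record (row 508): (z1ℓ) lives in the FINITE-STRAIN RELAXED regime
`d(L) ∈ [s, 1/8]`, every clean `w` ⇒ worst case = relaxed stacking, `c_hom = 3.40` (type 3); the quadratic-regime `c_W = 0.859` (fcc coupled dxx–eyz
mode) is the near-well Gårding constant relevant to X / (C), not to Z_E.

## Designated next cut (NOT typed here — definition request D-g29-1): (HD) ⟸ (A) harmonic APPROXIMATION ∧ (D) linear DECAY ∧ (T) tail
(A): the registered displacement of a GSC configuration is H1BD-close (defect `≤ ω(η)·η`) to an `L_lay`-harmonic field of the chart's force-constant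
operator on the half window; (D): `L_lay`-harmonic fields on layered equilibrium charts re-chart with the `t²` law (interior Campanato estimate for the
laminate operator — from `LayeredLiouvilleCert` by compactness, or directly); (T): the `r⁻⁸` interaction tail of the exterior enters (A) as a source of
size `≤ C ρ⁻²`.  D-g29-1 = «window-harmonic displacement fields for the NONLOCAL layered LJ kernel: exterior data convention + tail currency»; the glue
(HD) ⟸ (A) ∧ (D) ∧ (T) is then finsum-triangle bookkeeping PLUS a re-charting lemma (affine-layered Taylor part ↦ new equilibrium chart), typed once
D-g29-1 is ruled (lens-2 g30 candidate).
-/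

noncomputable section

open scoped BigOperators InnerProductSpace RealInnerProductSpace
open MeasureTheory Set Metric Filter Topology
open Summit.AtomisticToContinuum.Crystallization.Theorems.ChartedPlanarOrderRigidityDoor
  (E3 IsClean IsNash IsCharted IsEStarGSC VisibleGap PertRegime atomsIn siteEnergy eStar BindingSurface)
open Summit.AtomisticToContinuum.Crystallization.Theorems.ChartedPlanarOrderDensityDichotomy (μS IsSep nK nK_nonneg excess)
open Summit.AtomisticToContinuum.Crystallization.Theorems.ChartedPlanarOrderMesoCut (IsDoorSet NearHom LayeredHom EnvClose)
open Summit.AtomisticToContinuum.Crystallization.Theorems.OverbindingBudgetLiouvilleDictionary (NearHomBD)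
open Summit.AtomisticToContinuum.Crystallization.Theorems.ChartedPlanarOrderDoorLayered
  (TwoPeriodic DoorPeriodic PeriodicBulkGapDoor gap_and_pert_1_50_of_periodic NearHomL2BD nearHomL2BD_mono nearHomBD_of_nearHomL2BD
   sq_le_finsum_mem not_nearHomL2BD_singleton envClose_mono)
open Summit.AtomisticToContinuum.Crystallization.Theorems.ChartedPlanarOrderDoorLayeredOsc (IsTwoShellAffineGood DoorPeriodicOsc)
open Summit.AtomisticToContinuum.Crystallization.Theorems.ChartedPlanarOrderCleanScaleP
  (IsCleanP IsDoorSetP DoorPeriodicP isDoorSetP_mono doorPeriodic_of_doorPeriodicP isDoorSetP_one_iff doorPeriodicP_one_iff)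
open Literature.MathematicalPhysics.StatisticalMechanics (haggLabel barlowOffset layerNormal IsHaggSeq)

namespace Summit.AtomisticToContinuum.Crystallization.Theorems.ChartedZeroExcessLayeredLatticeLiouville

/-! ## §II.1  The DISPLACEMENT-LEVEL currencies `NearHomH1BD`, `NearHomH1BDE` (definition request D-g28-1 executed) -/

/-- **equilibrium chart** `IsEquilChart a s Λ L w`: the chart `L` has operator bounds `Λ`, is `s`-conformal about the scale `a` (part O `IsConfChart`), and
the homogeneous layered configuration `LayeredHom L w` is CLEAN and single-site NASH (tree predicates of N, verbatim the hypotheses under which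
`LayeredLiouvilleCert` certifies the linearised theory).  The reference state of the Caccioppoli expansion must be force-free: a Bravais chart is so by
inversion symmetry, a layered chart only at equilibrium stacking data `w` (relaxed shifts, Cauchy–Born for multilattices [EMing2006]). [this file, g29] -/
def IsEquilChart (a s Λ : ℝ) (L : E3 ≃L[ℝ] E3) (w : ℤ → E3) : Prop :=
  ‖(L : E3 →L[ℝ] E3)‖ ≤ Λ ∧ ‖(L.symm : E3 →L[ℝ] E3)‖ ≤ Λ ∧ IsConfChart a s (L : E3 →L[ℝ] E3) ∧
    IsClean (μS (LayeredHom (L : E3 →L[ℝ] E3) w)) ∧ IsNash (μS (LayeredHom (L : E3 →L[ℝ] E3) w))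

/-- **registration data** `IsRegistered κ r ρ S Q H Ψ τ`: `Ψ` injects the window `Q` into the model `H` with two-sided environment closeness `τ x` at range
`r` (as in every misfit currency of record) AND (i) REGISTRATION CONSISTENCY — the displacement `u := x − Ψ x` has discrete gradient dominated by the misfit
profile: `dist (p − x) (Ψ p − Ψ x) = ‖u p − u x‖ ≤ τ x` for `p ∈ Q` within `r` of `x`; (ii) misfit (= GRADIENT) level `∑ τ² ≤ κ·#Q`; (iii) POSITION level
`∑ ‖x − Ψ x‖² ≤ κ·ρ²·#Q` at scale `ρ` (the Poincaré-normalised L² size of `u`). [this file, g29] -/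
def IsRegistered (κ r ρ : ℝ) (S Q H : Set E3) (Ψ : E3 → E3) (τ : E3 → ℝ) : Prop :=
  Set.InjOn Ψ Q ∧ Set.MapsTo Ψ Q H ∧ (∀ x ∈ Q, 0 ≤ τ x ∧ EnvClose (τ x) r S x H (Ψ x)) ∧
    (∀ x ∈ Q, ∀ p ∈ Q, dist p x ≤ r → dist (p - x) (Ψ p - Ψ x) ≤ τ x) ∧
    ∑ᶠ x ∈ Q, τ x ^ 2 ≤ κ * nK Q ∧ ∑ᶠ x ∈ Q, ‖x - Ψ x‖ ^ 2 ≤ κ * ρ ^ 2 * nK Q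

/-- ★ **`NearHomH1BD Λ κ r ρ S Q`** (D-g28-1) — the REGISTERED (displacement-level) companion of `NearHomL2BD Λ κ r S Q`: same chart class
(`‖L‖, ‖L⁻¹‖ ≤ Λ`, free stacking data `w`), registration data at gradient level `κ` and position level `κ·ρ²`. [this file, g29] -/
def NearHomH1BD (Λ κ r ρ : ℝ) (S Q : Set E3) : Prop :=
  ∃ (L : E3 ≃L[ℝ] E3), ‖(L : E3 →L[ℝ] E3)‖ ≤ Λ ∧ ‖(L.symm : E3 →L[ℝ] E3)‖ ≤ Λ ∧
    ∃ (w : ℤ → E3) (Ψ : E3 → E3) (τ : E3 → ℝ), IsRegistered κ r ρ S Q (LayeredHom (L : E3 →L[ℝ] E3) w) Ψ τ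

/-- ★★ **`NearHomH1BDE a s Λ κ r ρ S Q`** — registered-flat under an EQUILIBRIUM chart (`IsEquilChart a s Λ L w`): the currency in which (P), (HD), (C) are
stated.  Dictionary (PROVED below): `H1BDE ⇒ H1BD ⇒ L2BD`, `H1BDE ⇒ L2BDL` (projections), monotone in `κ`, in `ρ` and in the tolerance `s`. [this file, g29] -/
def NearHomH1BDE (a s Λ κ r ρ : ℝ) (S Q : Set E3) : Prop :=
  ∃ (L : E3 ≃L[ℝ] E3) (w : ℤ → E3), IsEquilChart a s Λ L w ∧
    ∃ (Ψ : E3 → E3) (τ : E3 → ℝ), IsRegistered κ r ρ S Q (LayeredHom (L : E3 →L[ℝ] E3) w) Ψ τ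

/-- registration data are monotone in the level. [this file, g29] -/
theorem IsRegistered.mono {κ κ' r ρ : ℝ} (hκ : κ ≤ κ') {S Q H : Set E3} {Ψ : E3 → E3} {τ : E3 → ℝ}
    (h : IsRegistered κ r ρ S Q H Ψ τ) : IsRegistered κ' r ρ S Q H Ψ τ := by
  obtain ⟨h1, h2, h3, h4, h5, h6⟩ := h
  refine ⟨h1, h2, h3, h4, h5.trans (mul_le_mul_of_nonneg_right hκ (nK_nonneg Q)), h6.trans ?_⟩
  exact mul_le_mul_of_nonneg_right (mul_le_mul_of_nonneg_right hκ (sq_nonneg ρ)) (nK_nonneg Q)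

/-- registration data are monotone in the position scale (`0 ≤ ρ ≤ ρ'`, `0 ≤ κ`). [this file, g29] -/
theorem IsRegistered.mono_scale {κ r ρ ρ' : ℝ} (hκ : 0 ≤ κ) (hρ : 0 ≤ ρ) (hρρ' : ρ ≤ ρ') {S Q H : Set E3} {Ψ : E3 → E3} {τ : E3 → ℝ}
    (h : IsRegistered κ r ρ S Q H Ψ τ) : IsRegistered κ r ρ' S Q H Ψ τ := by
  obtain ⟨h1, h2, h3, h4, h5, h6⟩ := h
  refine ⟨h1, h2, h3, h4, h5, h6.trans ?_⟩
  exact mul_le_mul_of_nonneg_right (mul_le_mul_of_nonneg_left (pow_le_pow_left₀ hρ hρρ' 2) hκ) (nK_nonneg Q)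

/-- dictionary: registered-flat ⇒ misfit-flat (`NearHomH1BD ⇒ NearHomL2BD`, a projection). [this file, g29] -/
theorem nearHomL2BD_of_H1BD {Λ κ r ρ : ℝ} {S Q : Set E3} (h : NearHomH1BD Λ κ r ρ S Q) : NearHomL2BD Λ κ r S Q := by
  obtain ⟨L, hL, hL', w, Ψ, τ, h1, h2, h3, _, h5, _⟩ := h
  exact ⟨L, hL, hL', w, Ψ, τ, h1, h2, h3, h5⟩

/-- dictionary: `NearHomH1BDE ⇒ NearHomH1BD` (forget conformality, cleanliness and Nash of the chart). [this file, g29] -/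
theorem nearHomH1BD_of_H1BDE {a s Λ κ r ρ : ℝ} {S Q : Set E3} (h : NearHomH1BDE a s Λ κ r ρ S Q) : NearHomH1BD Λ κ r ρ S Q := by
  obtain ⟨L, w, ⟨hL, hL', _, _, _⟩, Ψ, τ, hreg⟩ := h
  exact ⟨L, hL, hL', w, Ψ, τ, hreg⟩

/-- dictionary: `NearHomH1BDE ⇒ NearHomL2BDL` (the rigid-chart misfit currency of part P; a projection). [this file, g29] -/
theorem nearHomL2BDL_of_H1BDE {a s Λ κ r ρ : ℝ} {S Q : Set E3} (h : NearHomH1BDE a s Λ κ r ρ S Q) : NearHomL2BDL a s Λ κ r S Q := by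
  obtain ⟨L, w, ⟨hL, hL', hc, _, _⟩, Ψ, τ, h1, h2, h3, _, h5, _⟩ := h
  exact ⟨L, hL, hL', hc, w, Ψ, τ, h1, h2, h3, h5⟩

/-- dictionary: `NearHomH1BDE ⇒ NearHomL2BD`. [this file, g29] -/
theorem nearHomL2BD_of_H1BDE {a s Λ κ r ρ : ℝ} {S Q : Set E3} (h : NearHomH1BDE a s Λ κ r ρ S Q) : NearHomL2BD Λ κ r S Q :=
  nearHomL2BD_of_H1BD (nearHomH1BD_of_H1BDE h)

/-- `NearHomH1BD` is monotone in the level. [this file, g29] -/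
theorem nearHomH1BD_mono {Λ κ κ' r ρ : ℝ} (hκ : κ ≤ κ') {S Q : Set E3} (h : NearHomH1BD Λ κ r ρ S Q) : NearHomH1BD Λ κ' r ρ S Q := by
  obtain ⟨L, hL, hL', w, Ψ, τ, hreg⟩ := h
  exact ⟨L, hL, hL', w, Ψ, τ, hreg.mono hκ⟩

/-- `NearHomH1BDE` is monotone in the level. [this file, g29] -/
theorem nearHomH1BDE_mono {a s Λ κ κ' r ρ : ℝ} (hκ : κ ≤ κ') {S Q : Set E3} (h : NearHomH1BDE a s Λ κ r ρ S Q) :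
    NearHomH1BDE a s Λ κ' r ρ S Q := by
  obtain ⟨L, w, hE, Ψ, τ, hreg⟩ := h
  exact ⟨L, w, hE, Ψ, τ, hreg.mono hκ⟩

/-- `NearHomH1BDE` is monotone in the conformality tolerance (`s ≤ s'`, `0 ≤ a`). [this file, g29] -/
theorem nearHomH1BDE_of_tol {a s s' Λ κ r ρ : ℝ} (hs : s ≤ s') (ha : 0 ≤ a) {S Q : Set E3} (h : NearHomH1BDE a s Λ κ r ρ S Q) :
    NearHomH1BDE a s' Λ κ r ρ S Q := by
  obtain ⟨L, w, ⟨hL, hL', hc, hcl, hn⟩, Ψ, τ, hreg⟩ := h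
  exact ⟨L, w, ⟨hL, hL', hc.mono hs ha, hcl, hn⟩, Ψ, τ, hreg⟩

/-- TEETH inherited: every non-vacuity witness of the misfit currency transfers (`¬ L2BD ⇒ ¬ H1BD`), e.g. `not_nearHomL2BD_singleton`, (w1), (w2). [this file, g29] -/
theorem not_nearHomH1BD_of_not_L2BD {Λ κ r ρ : ℝ} {S Q : Set E3} (h : ¬ NearHomL2BD Λ κ r S Q) : ¬ NearHomH1BD Λ κ r ρ S Q :=
  fun h' => h (nearHomL2BD_of_H1BD h')

/-- **non-junk inhabitant of the registration clauses**: a window of the model itself is registered by the identity at level `0` (every scale `ρ`). [this file, g29] -/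
theorem isRegistered_self (r ρ : ℝ) {H Q : Set E3} (hQ : Q ⊆ H) : IsRegistered 0 r ρ H Q H (fun x => x) (fun _ => 0) := by
  refine ⟨fun x _ y _ hxy => hxy, fun x hx => hQ hx, fun x _ => ⟨le_rfl, ?_, ?_⟩, ?_, ?_, ?_⟩
  · intro p hp _
    exact ⟨p, hp, by simp⟩
  · intro q hq _
    exact ⟨q, hq, by simp⟩
  · intro x _ p _ _
    simp
  · simp
  · simp

/-- ★ **non-junk inhabitant of `NearHomH1BD`**: a window `Q` of a layered model `LayeredHom L w` with `‖L‖, ‖L⁻¹‖ ≤ Λ` is registered-flat at level `0`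
under its own chart (identity registration) — the clauses are jointly satisfiable and say what they should on the model. [this file, g29] -/
theorem nearHomH1BD_self {Λ r ρ : ℝ} (L : E3 ≃L[ℝ] E3) (w : ℤ → E3) (hL : ‖(L : E3 →L[ℝ] E3)‖ ≤ Λ) (hL' : ‖(L.symm : E3 →L[ℝ] E3)‖ ≤ Λ)
    {Q : Set E3} (hQ : Q ⊆ LayeredHom (L : E3 →L[ℝ] E3) w) : NearHomH1BD Λ 0 r ρ (LayeredHom (L : E3 →L[ℝ] E3) w) Q :=
  ⟨L, hL, hL', w, fun x => x, fun _ => 0, isRegistered_self r ρ hQ⟩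

/-- **inhabitant of `NearHomH1BDE` modulo the chart class**: a window of an EQUILIBRIUM chart is registered-flat at level `0` under it.  (The class
`IsEquilChart a s Λ` is inhabited iff some `s`-conformal clean homogeneous layered state is single-site Nash — e.g. fcc at the e⋆-scale: force-free by
inversion symmetry; its single-site STABILITY is certified numerics (census TAG 174 family; [Ayala–Choksi–Wirth arXiv:2506.22614] for finite fcc LJ
crystals), not a tree theorem — recorded, not claimed.) [this file, g29] -/
theorem nearHomH1BDE_self {a s Λ r ρ : ℝ} {L : E3 ≃L[ℝ] E3} {w : ℤ → E3} (hE : IsEquilChart a s Λ L w) {Q : Set E3}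
    (hQ : Q ⊆ LayeredHom (L : E3 →L[ℝ] E3) w) : NearHomH1BDE a s Λ 0 r ρ (LayeredHom (L : E3 →L[ℝ] E3) w) Q :=
  ⟨L, w, hE, fun x => x, fun _ => 0, isRegistered_self r ρ hQ⟩

/-! ## §II.2  The three pieces beneath H♭^ℓ: (P) registration, (HD) harmonic-replacement decay [+ its t²-law (HD²)], (C) Caccioppoli -/

/-- ★ **(P) «RegistrationP aHi Λ θ s»** — misfit-flat ⇒ REGISTERED-flat: for every `δ` and scale `a > 0` there are `C ≥ 1`, `M ≥ 1`, a ceiling `η₁` and a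
floor `R₁` such that on θ-good `aHi`-door sets (GSC-FREE door `IsDoorSetP`: rooted, separated, clean, Nash, charted) «`η`-flat at radius `M·R` under an
`s`-conformal chart about `a` ⇒ registered-flat at level `C·η`, position scale `R`, radius `R`, under an EQUILIBRIUM `s`-conformal chart».  RIGIDITY +
EQUILIBRIUM-type (discrete FJM registration on clean charted sets: small misfit ⇒ the environment matching can be chosen as a site registration with
consistent neighbours, then Poincaré; Nash of `S` puts the window's mean stacking within `C√η` of an equilibrium stacking (nondegenerate interlayer
stiffness), re-fit cost `≤ C η` per site).  UNDECIDED · TRUE-type · ATTACKABLE·M.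
Why it might fail: needs «no clean ALMOST-equilibrium stacking far from an equilibrium one» — per-layer force of `LayeredHom L w` ≥ c_F·dist(w, equilibrium
stackings) on the clean slice (census TAG «FORCE»; near equilibrium (g0) λ_min = 1.72 > 0); at the tube edge θ = 1/16 the re-fitted chart may leave the clean class.
Sources: [kruzik2019 p.55 Thm 1.1.12 (FJM)], [Theil2006], [FlatleyTheil2015], [EMing2006]. [this file, g29] -/
def RegistrationP (aHi Λ θ s : ℝ) : Prop :=
  ∀ δ : ℝ, 0 < δ → ∀ a : ℝ, 0 < a → ∃ C : ℝ, 1 ≤ C ∧ ∃ M : ℝ, 1 ≤ M ∧ ∃ η₁ : ℝ, 0 < η₁ ∧ ∃ R₁ : ℝ, 0 < R₁ ∧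
    ∀ S : Set E3, IsDoorSetP aHi δ S → (∀ q ∈ S, IsTwoShellAffineGood θ S q) →
      ∀ η : ℝ, 0 < η → η ≤ η₁ → ∀ R : ℝ, R₁ ≤ R →
        NearHomL2BDL a s Λ η 4 S (atomsIn (μS S) 0 (M * R)) → NearHomH1BDE a s Λ (C * η) 4 R S (atomsIn (μS S) 0 R)

/-- ★★ **(HD) «HarmonicDecayPGL aHi Λ θ s s'»** — THE REGULARITY LEAF (harmonic approximation + linear decay, merged): given the two linear certificates,
for every `δ`, scale `a > 0` and CONTRACTION TARGET `c > 0` there are a radius ratio `t ∈ (0,1]`, a ceiling `η₁` and a floor `R₁` such that on θ-good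
`aHi`-GSC-door sets «registered-flat at `(radius = scale = R, level η)` under an equilibrium `s`-conformal chart ⇒ registered-flat at `(t·R, c·η)` under an
equilibrium `s'`-conformal chart» (`s' ≥ s` absorbs the chart correction; column instance `s' = 2s`).  Mechanism: replace the registered displacement `u`
on the window by the `L_lay`-harmonic field `h` with the same exterior data ((A): `u − h` small in H1BD by minimality transfer + `LayeredStable`
coercivity; nonlocal `r⁻⁸` tail as a `ρ⁻²` source), let `h` decay ((D): interior Campanato estimate for the laminate operator, qualitative form =
`LayeredLiouvilleCert`), re-chart by the affine-layered Taylor part of `h` at `t·R` (new equilibrium chart within `C√η` of the old).  REGULARITY-type for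
minimisers; UNDECIDED · TRUE-type · ATTACKABLE·L.  (HD²) below is its `t²`-law form; (HD) ⟸ (HD²) PROVED.
Why it might fail: the laminate operator of a clean-but-soft stacking may lack a uniform interior (Campanato) constant — (D) is certified only
qualitatively by `LayeredLiouvilleCert`; and minimality transfer across the nonlocal tail needs the exterior registered too (only the window is).
Sources: [giaquinta1984 p.120 Thm 3.1, pp 94–122 (Ch. VI), pp 142–145 (Ch. IX)], [hildebrandt1988 p.84], [Beck, Elliptic Regularity Theory (UMI LN)],
[EMing2006]. [this file, g29] -/
def HarmonicDecayPGL (aHi Λ θ s s' : ℝ) : Prop :=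
  LatticeLiouvilleCert → LayeredLiouvilleCert → ∀ δ : ℝ, 0 < δ → ∀ a : ℝ, 0 < a → ∀ c : ℝ, 0 < c →
    ∃ t : ℝ, 0 < t ∧ t ≤ 1 ∧ ∃ η₁ : ℝ, 0 < η₁ ∧ ∃ R₁ : ℝ, 0 < R₁ ∧
      ∀ S : Set E3, IsDoorSetPG aHi δ S → (∀ q ∈ S, IsTwoShellAffineGood θ S q) →
        ∀ η : ℝ, 0 < η → η ≤ η₁ → ∀ R : ℝ, R₁ ≤ R →
          NearHomH1BDE a s Λ η 4 R S (atomsIn (μS S) 0 R) → NearHomH1BDE a s' Λ (c * η) 4 (t * R) S (atomsIn (μS S) 0 (t * R))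

/-- ★ **(HD²) «HarmonicDecayLawPGL aHi Λ θ s s'»** — the `t²`-LAW form of (HD): one constant `C_d` such that for EVERY ratio `t ∈ (0,1]` (ceiling and floor
depending on `t`) registered-flat at `(R, η)` ⇒ registered-flat at `(t·R, C_d·t²·η)`.  This is the shape the mechanism actually delivers (affine Taylor
remainder of a harmonic field); STRONGER than (HD) (seam `harmonicDecayPGL_of_law`, PROVED).  UNDECIDED · TRUE-type · ATTACKABLE·L.
Why it might fail: as (HD); in addition the exponent 2 requires a C^{2}-type interior estimate for the laminate operator uniformly over clean equilibrium
stackings (a C^{1,α} estimate would give `t^{1+α}` only — still enough for (HD)).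
Sources: [giaquinta1984 pp 94–122], [hildebrandt1988 p.84], [Goldman–Otto, variational partial regularity (harmonic approximation without E–L)]. [this file, g29] -/
def HarmonicDecayLawPGL (aHi Λ θ s s' : ℝ) : Prop :=
  LatticeLiouvilleCert → LayeredLiouvilleCert → ∀ δ : ℝ, 0 < δ → ∀ a : ℝ, 0 < a → ∃ Cd : ℝ, 0 < Cd ∧ ∀ t : ℝ, 0 < t → t ≤ 1 →
    ∃ η₁ : ℝ, 0 < η₁ ∧ ∃ R₁ : ℝ, 0 < R₁ ∧
      ∀ S : Set E3, IsDoorSetPG aHi δ S → (∀ q ∈ S, IsTwoShellAffineGood θ S q) →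
        ∀ η : ℝ, 0 < η → η ≤ η₁ → ∀ R : ℝ, R₁ ≤ R →
          NearHomH1BDE a s Λ η 4 R S (atomsIn (μS S) 0 R) → NearHomH1BDE a s' Λ (Cd * t ^ 2 * η) 4 (t * R) S (atomsIn (μS S) 0 (t * R))

/-- ★ **(C) «CaccioppoliPGL aHi Λ θ s»** — the discrete CACCIOPPOLI inequality for minimisers: for every `δ` and scale `a > 0` there are `C ≥ 1`, `M ≥ 1`, a
ceiling `η₁` and a floor `R₁` such that on θ-good `aHi`-GSC-door sets «registered-flat at `(radius = scale = M·R, level η)` under an equilibrium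
`s`-conformal chart ⇒ misfit-flat (`NearHomL2BD`, gradient level) `C·η` at radius `R`» — position controls gradient one radius down, AT A LOSS.
MINIMALITY-type (e⋆-μ-GSC tested against the competitor «atoms onto the registered chart sites inside `B_{R}`, unchanged outside `B_{MR}`, cut-off
interpolation on the collar», SAME particle number; reference force-free because the chart is an equilibrium chart, so the expansion starts at second
order (X-type Gårding from below); the Chebyshev-bad collar atoms (`#{|u| ≳ R} ≤ C η·#`) are DELETED, which μ = e⋆ prices at `|e⋆|` each — within budget).
UNDECIDED · TRUE-type · ATTACKABLE·M.
Why it might fail: the lower Gårding bound «window excess ≥ c·∑τ² − C R²» is X-type and needs Hessian positivity on the conformal CORE slice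
(TAG 174 (a‴)); with a linearly unstable clean stacking the quadratic form does not control the misfit and (C) fails as typed.
Sources: [giaquinta1984 pp 142–145 (Ch. IX: Caccioppoli from minimality alone)], [Evans2010], [EMing2006], [Theil2006]. [this file, g29] -/
def CaccioppoliPGL (aHi Λ θ s : ℝ) : Prop :=
  ∀ δ : ℝ, 0 < δ → ∀ a : ℝ, 0 < a → ∃ C : ℝ, 1 ≤ C ∧ ∃ M : ℝ, 1 ≤ M ∧ ∃ η₁ : ℝ, 0 < η₁ ∧ ∃ R₁ : ℝ, 0 < R₁ ∧
    ∀ S : Set E3, IsDoorSetPG aHi δ S → (∀ q ∈ S, IsTwoShellAffineGood θ S q) →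
      ∀ η : ℝ, 0 < η → η ≤ η₁ → ∀ R : ℝ, R₁ ≤ R →
        NearHomH1BDE a s Λ η 4 (M * R) S (atomsIn (μS S) 0 (M * R)) → NearHomL2BD Λ (C * η) 4 S (atomsIn (μS S) 0 R)

/-- ★ **(HD) ⟸ (HD²) (PROVED)**: the `t²` law yields every contraction target (`t := min 1 (c/(C_d + c))`). [this file, g29] -/
theorem harmonicDecayPGL_of_law {aHi Λ θ s s' : ℝ} (h : HarmonicDecayLawPGL aHi Λ θ s s') : HarmonicDecayPGL aHi Λ θ s s' := by
  intro hL hL' δ hδ a ha c hc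
  obtain ⟨Cd, hCd, h'⟩ := h hL hL' δ hδ a ha
  have ht0 : 0 < min 1 (c / (Cd + c)) := lt_min one_pos (div_pos hc (by positivity))
  have ht1 : min 1 (c / (Cd + c)) ≤ 1 := min_le_left _ _
  obtain ⟨η₁, hη₁, R₁, hR₁, h''⟩ := h' (min 1 (c / (Cd + c))) ht0 ht1
  refine ⟨min 1 (c / (Cd + c)), ht0, ht1, η₁, hη₁, R₁, hR₁, fun S hSd hg η hη hηle R hR hreg => ?_⟩
  have hle : min 1 (c / (Cd + c)) ≤ c / (Cd + c) := min_le_right _ _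
  have hsq : min 1 (c / (Cd + c)) ^ 2 ≤ min 1 (c / (Cd + c)) := by nlinarith
  have hCdc : Cd * (c / (Cd + c)) ≤ c := by
    rw [mul_div_assoc', div_le_iff₀ (by positivity)]
    nlinarith [mul_pos hc hc]
  have hlev : Cd * min 1 (c / (Cd + c)) ^ 2 * η ≤ c * η := by
    apply mul_le_mul_of_nonneg_right _ hη.le
    calc Cd * min 1 (c / (Cd + c)) ^ 2 ≤ Cd * min 1 (c / (Cd + c)) := mul_le_mul_of_nonneg_left hsq hCd.le
      _ ≤ Cd * (c / (Cd + c)) := mul_le_mul_of_nonneg_left hle hCd.le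
      _ ≤ c := hCdc
  exact nearHomH1BDE_mono hlev (h'' S hSd hg η hη hηle R hR hreg)

/-! ## §II.3  ★★★ The glue: H♭^ℓ ⟸ (P) ∧ (HD) ∧ (C) — PROVED (pure bookkeeping of levels and radii) -/

/-- ★★★ **H♭^ℓ(aHi;Λ,θ,s) ⟸ (P)(s) ∧ (HD)(s,s') ∧ (C)(s') (PROVED)**: misfit `η` at `M·R` —(P)→ registered `C_P η` at `M_c R/t` —(HD, target
`c = 1/(2 C_c C_P)`)→ registered `c C_P η` at `M_c R` —(C)→ misfit `C_c c C_P η = η/2` at `R`; `M := M_P M_c / t`, basin `min (η_P, η₁/C_P, 2 C_c η_c)`,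
floor `max (R_P, R₁, R_c)`. [this file, g29] -/
theorem halvingBasinPGL_of_reg_harm_cacc {aHi Λ θ s s' : ℝ} (hP : RegistrationP aHi Λ θ s) (hH : HarmonicDecayPGL aHi Λ θ s s')
    (hC : CaccioppoliPGL aHi Λ θ s') : HalvingBasinPGL aHi Λ θ s := by
  intro hL hL' δ hδ a ha
  obtain ⟨CP, hCP, MP, hMP, ηP, hηP, RP, hRP, hP'⟩ := hP δ hδ a ha
  obtain ⟨Cc, hCc, Mc, hMc, ηc, hηc, Rc, hRc, hC'⟩ := hC δ hδ a ha
  have hCP0 : 0 < CP := zero_lt_one.trans_le hCP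
  have hCc0 : 0 < Cc := zero_lt_one.trans_le hCc
  have hMP0 : 0 < MP := zero_lt_one.trans_le hMP
  have hMc0 : 0 < Mc := zero_lt_one.trans_le hMc
  obtain ⟨t, ht, ht1, η₁, hη₁, R₁, hR₁, hH'⟩ := hH hL hL' δ hδ a ha (1 / (2 * Cc * CP)) (by positivity)
  have hM1 : 1 ≤ MP * Mc / t :=
    (one_le_mul_of_one_le_of_one_le hMP hMc).trans (le_div_self (by positivity) ht ht1)
  refine ⟨min ηP (min (η₁ / CP) (2 * Cc * ηc)), lt_min hηP (lt_min (div_pos hη₁ hCP0) (by positivity)), MP * Mc / t, hM1,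
    max RP (max R₁ Rc), lt_max_of_lt_left hRP, fun S hSd hg η hη hηle R hR hflat => ?_⟩
  have hRP_R : RP ≤ R := (le_max_left _ _).trans hR
  have hR1_R : R₁ ≤ R := ((le_max_left _ _).trans (le_max_right _ _)).trans hR
  have hRc_R : Rc ≤ R := ((le_max_right _ _).trans (le_max_right _ _)).trans hR
  have hR0 : 0 ≤ R := hRc.le.trans hRc_R
  have hRρ : R ≤ Mc * R / t := (le_mul_of_one_le_left hR0 hMc).trans (le_div_self (by positivity) ht ht1)
  -- step (P): misfit-flat at `MP·ρ`, `ρ := Mc·R/t`  ⇒  registered-flat at `ρ`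
  have hrad1 : MP * Mc / t * R = MP * (Mc * R / t) := by ring
  rw [hrad1] at hflat
  have h1 := hP' S hSd.1 hg η hη (hηle.trans (min_le_left _ _)) (Mc * R / t) (hRP_R.trans hRρ) hflat
  -- step (HD): registered-flat at `ρ` ⇒ registered-flat at `t·ρ = Mc·R`, level contracted by `c`
  have hlev1 : CP * η ≤ η₁ := by
    have h := hηle.trans ((min_le_right _ _).trans (min_le_left _ _))
    rw [le_div_iff₀ hCP0] at h
    linarith
  have h2 := hH' S hSd hg (CP * η) (by positivity) hlev1 (Mc * R / t) (hR1_R.trans hRρ) h1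
  have hrad2 : t * (Mc * R / t) = Mc * R := by field_simp
  rw [hrad2] at h2
  -- step (C): registered-flat at `Mc·R` ⇒ misfit-flat at `R`
  have hlev2 : 1 / (2 * Cc * CP) * (CP * η) ≤ ηc := by
    have h := hηle.trans ((min_le_right _ _).trans (min_le_right _ _))
    have heq : 1 / (2 * Cc * CP) * (CP * η) = η / (2 * Cc) := by field_simp
    rw [heq, div_le_iff₀ (by positivity)]
    linarith
  have h3 := hC' S hSd hg (1 / (2 * Cc * CP) * (CP * η)) (by positivity) hlev2 R hRc_R h2
  have hfin : Cc * (1 / (2 * Cc * CP) * (CP * η)) = η / 2 := by field_simp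
  rw [hfin] at h3
  exact h3

/-- ★★ **H♭^ℓ ⟸ (P) ∧ (HD²) ∧ (C) (PROVED)** — with the `t²`-law leaf. [this file, g29] -/
theorem halvingBasinPGL_of_reg_law_cacc {aHi Λ θ s s' : ℝ} (hP : RegistrationP aHi Λ θ s) (hH : HarmonicDecayLawPGL aHi Λ θ s s')
    (hC : CaccioppoliPGL aHi Λ θ s') : HalvingBasinPGL aHi Λ θ s :=
  halvingBasinPGL_of_reg_harm_cacc hP (harmonicDecayPGL_of_law hH) hC

/-- ★ **H♭_G ⟸ Z_L ∧ (P) ∧ (HD) ∧ (C) (PROVED)** — down to part M's `HalvingBasinPG` through part PB's `halvingBasinPG_of_confL`. [this file, g29] -/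
theorem halvingBasinPG_of_confL_reg_harm_cacc {aHi Λ θ s s' : ℝ} (hZ : ConformalChartLocalisationPG aHi Λ θ s) (hP : RegistrationP aHi Λ θ s)
    (hH : HarmonicDecayPGL aHi Λ θ s s') (hC : CaccioppoliPGL aHi Λ θ s') : HalvingBasinPG aHi Λ θ :=
  halvingBasinPG_of_confL hZ (halvingBasinPGL_of_reg_harm_cacc hP hH hC)

/-! ## §II.4  ★ Columns (`s = 1/50`, corrected-chart tolerance `s' = 1/25`) -/

/-- ★★★ **COLUMN `_16XH3` — NINE opaque leaves, THE COLUMN OF THIS NODE**: `LatticeLiouvilleCert → LayeredLiouvilleCert → R_G(1;2,1/16,1/16) →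
X(1;2,1/16,1/16) → Z_E(1;2,1/16,1/50) → P(1;2,1/16,1/50) → HD(1;2,1/16,1/50,1/25) → C(1;2,1/16,1/25) → PeriodicBulkGapDoor 2 →
VisibleGap (1/50) ∧ PertRegime (1/50)`. [this file, g29] -/
theorem gap_and_pert_1_50_of_certs_16XH3 (hL : LatticeLiouvilleCert) (hL' : LayeredLiouvilleCert)
    (hR : OscRigidityL2BDPG 1 2 (1 / 16) (1 / 16)) (hX : ExcessFlatnessControlP 1 2 (1 / 16) (1 / 16))
    (hE : ExcessChartLocalisationP 1 2 (1 / 16) (1 / 50)) (hP : RegistrationP 1 2 (1 / 16) (1 / 50))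
    (hHd : HarmonicDecayPGL 1 2 (1 / 16) (1 / 50) (1 / 25)) (hCc : CaccioppoliPGL 1 2 (1 / 16) (1 / 25))
    (hG : PeriodicBulkGapDoor 2) : VisibleGap (1 / 50) ∧ PertRegime (1 / 50) :=
  gap_and_pert_1_50_of_certs_16XHl hL hL' hR hX hE (halvingBasinPGL_of_reg_harm_cacc hP hHd hCc) hG

/-- ★★ **COLUMN `_16XH3law` — NINE opaque leaves with the `t²`-law leaf (HD²) in place of (HD)**. [this file, g29] -/
theorem gap_and_pert_1_50_of_certs_16XH3law (hL : LatticeLiouvilleCert) (hL' : LayeredLiouvilleCert)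
    (hR : OscRigidityL2BDPG 1 2 (1 / 16) (1 / 16)) (hX : ExcessFlatnessControlP 1 2 (1 / 16) (1 / 16))
    (hE : ExcessChartLocalisationP 1 2 (1 / 16) (1 / 50)) (hP : RegistrationP 1 2 (1 / 16) (1 / 50))
    (hHd : HarmonicDecayLawPGL 1 2 (1 / 16) (1 / 50) (1 / 25)) (hCc : CaccioppoliPGL 1 2 (1 / 16) (1 / 25))
    (hG : PeriodicBulkGapDoor 2) : VisibleGap (1 / 50) ∧ PertRegime (1 / 50) :=
  gap_and_pert_1_50_of_certs_16XHl hL hL' hR hX hE (halvingBasinPGL_of_reg_law_cacc hP hHd hCc) hG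

/-- ★★ **COLUMN `_16XH3`, resolved form — THIRTEEN leaves (the audit column)**: `LJDecay → LJMoments → CleanCrystalStability → LayeredDecay →
LayeredMoments → LayeredCrystalStability → R_G → X → Z_E → P → HD → C → HBG″ → VisibleGap (1/50) ∧ PertRegime (1/50)`. [this file, g29] -/
theorem gap_and_pert_1_50_of_layered_pieces_16XH3 (hD : LJDecay) (hM : LJMoments) (hC : CleanCrystalStability)
    (hD' : LayeredDecay) (hM' : LayeredMoments) (hC' : LayeredCrystalStability)
    (hR : OscRigidityL2BDPG 1 2 (1 / 16) (1 / 16)) (hX : ExcessFlatnessControlP 1 2 (1 / 16) (1 / 16))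
    (hE : ExcessChartLocalisationP 1 2 (1 / 16) (1 / 50)) (hP : RegistrationP 1 2 (1 / 16) (1 / 50))
    (hHd : HarmonicDecayPGL 1 2 (1 / 16) (1 / 50) (1 / 25)) (hCc : CaccioppoliPGL 1 2 (1 / 16) (1 / 25))
    (hG : PeriodicBulkGapDoor 2) : VisibleGap (1 / 50) ∧ PertRegime (1 / 50) :=
  gap_and_pert_1_50_of_layered_pieces_16XHl hD hM hC hD' hM' hC' hR hX hE (halvingBasinPGL_of_reg_harm_cacc hP hHd hCc) hG

end Summit.AtomisticToContinuum.Crystallization.Theorems.ChartedZeroExcessLayeredLatticeLiouville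

end
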